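import Literature.RepresentationTheory.Kovacevic2021.SU21RelativeCochainsDegreeThree
import HarnessLib

/-!
# Kovačević's `SU(2,1)`-modules: relative `(𝔤, 𝔨)`-cochains of degree `4` — the invariant value and the
# vanishing criterion `C⁴ = 0`

Topic `RepresentationTheory/Kovacevic2021`; namespace `Literature.RepresentationTheory.Kovacevic2021`.
Theorems only (plus private plumbing); no named fact.  Sequel to `SU21RelativeCochainsDegreeThree` (slot
expansion `slot_expand`, horizontality `apply_eq_zero_of_slot_mem`).

`Λ⁴𝔭 = Λ²𝔭⁺ ⊗ Λ²𝔭⁻ = F_{0,0} = V_{1,0}` [BorelWallach2000, VI 4.8 (5), Lemma 4.9]: a relative `4`-cochain has a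
`𝔨`-invariant value `f(E₀₂, E₁₂, E₂₀, E₂₁)` (`apply_T_mem_hwSpace`, via the degree-`4` Lie derivative formula
`lieDer_four_apply`) which determines it, so **`C⁴(𝔤, 𝔨; V) = 0` unless `V_{1,0}` is a `K`-type**
(`relCochain_four_eq_bot`) — the input for `H³(D_i) = 0`-type statements and `H⁴ = 0` off `U(0)`
[BorelWallach2000, VI Thm 4.11].  NOT here: `dim C⁴ = [(1,0) ∈ S]` (the converse construction) and `C⁵ = 0`.

## References

* A. Borel, N. Wallach (2000), I §1.2 (1); VI 4.8 (5), Lemma 4.9, Thm 4.11, pp. 130–133 (held chunks p0059,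
  p0165–p0169). [BorelWallach2000]
* C. Chevalley, S. Eilenberg, Trans. AMS 63 (1948), §23 (23.3), (23.5), §28. [ChevalleyEilenberg1948]
* D. Kovačević, Acta Math. Spalatensia 1 (2021) 105–125, §3 Def 1. [Kovacevic2021]
-/

noncomputable section

open Finsupp Module
open Literature.Algebra.Lie Literature.Algebra.Lie.ChevalleyEilenberg

namespace Literature.RepresentationTheory.Kovacevic2021

-- Mathlib idiom (Mathlib/Algebra/Lie/OfAssociative.lean): bracket on `Matrix`/`Module.End` = commutator.
attribute [local instance 100] LieRing.ofAssociativeRing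

/-! ### The Lie derivative in degree `4` (any Lie algebra and module) -/

section Generic

variable {R : Type*} [CommRing R] {L : Type*} [LieRing L] [LieAlgebra R L]
  {M : Type*} [AddCommGroup M] [Module R M] [LieRingModule L M] [LieModule R L M]

/-- `(θ_x f)(y,z,w,u) = ⁅x, f(y,z,w,u)⁆ - f(⁅x,y⁆,z,w,u) - f(y,⁅x,z⁆,w,u) - f(y,z,⁅x,w⁆,u) - f(y,z,w,⁅x,u⁆)` in
degree `4`. [cite: ChevalleyEilenberg1948, §23 (23.3), (23.5)] -/
theorem lieDer_four_apply (x y z w u : L) (f : Cochain R L M 4) :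
    lieDer R L M 4 x f ![y, z, w, u] =
      ⁅x, f ![y, z, w, u]⁆ - f ![⁅x, y⁆, z, w, u] - f ![y, ⁅x, z⁆, w, u] - f ![y, z, ⁅x, w⁆, u]
        - f ![y, z, w, ⁅x, u⁆] := by
  have e := congrArg (fun φ : Cochain R L M 3 => φ ![z, w, u]) (ins_lieDer (R := R) (M := M) 3 x y f)
  simp only [AlternatingMap.sub_apply, ins_apply, lieDer_three_apply] at e
  have h1 : (Matrix.vecCons y ![z, w, u] : Fin 4 → L) = ![y, z, w, u] := rfl
  have h2 : (Matrix.vecCons y ![⁅x, z⁆, w, u] : Fin 4 → L) = ![y, ⁅x, z⁆, w, u] := rfl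
  have h3 : (Matrix.vecCons y ![z, ⁅x, w⁆, u] : Fin 4 → L) = ![y, z, ⁅x, w⁆, u] := rfl
  have h4 : (Matrix.vecCons y ![z, w, ⁅x, u⁆] : Fin 4 → L) = ![y, z, w, ⁅x, u⁆] := rfl
  have h5 : (Matrix.vecCons ⁅x, y⁆ ![z, w, u] : Fin 4 → L) = ![⁅x, y⁆, z, w, u] := rfl
  rw [h1, h2, h3, h4, h5] at e
  rw [e]
  abel

end Generic

namespace SU21Datum

variable (𝒟 : SU21Datum)

variable {𝒟} in
/-- slot expansion in degree `4` (literal arity, for rewriting) [cite: BorelWallach2000, I §1.2 (1)] -/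
theorem slot_expand4 {f : Cochain ℂ gl3 𝒟.V 4} (hf : f ∈ 𝒟.relCochain 4) (v : Fin 4 → gl3) (i : Fin 4) :
    f v = (v i) 0 2 • f (Function.update v i (E 0 2)) + (v i) 1 2 • f (Function.update v i (E 1 2))
      + (v i) 2 0 • f (Function.update v i (E 2 0)) + (v i) 2 1 • f (Function.update v i (E 2 1)) :=
  slot_expand hf v i

/-! ### Slot calculus in degree `4` -/

section Slots

variable {𝒟}

/-- updating slot `0` of a `4`-tuple [folklore] -/
private theorem upd4_0 (a b c d x : gl3) : Function.update ![a, b, c, d] 0 x = ![x, b, c, d] := by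
  funext j
  fin_cases j <;> rfl

/-- updating slot `1` of a `4`-tuple [folklore] -/
private theorem upd4_1 (a b c d x : gl3) : Function.update ![a, b, c, d] 1 x = ![a, x, c, d] := by
  funext j
  fin_cases j <;> rfl

/-- updating slot `2` of a `4`-tuple [folklore] -/
private theorem upd4_2 (a b c d x : gl3) : Function.update ![a, b, c, d] 2 x = ![a, b, x, d] := by
  funext j
  fin_cases j <;> rfl

/-- updating slot `3` of a `4`-tuple [folklore] -/
private theorem upd4_3 (a b c d x : gl3) : Function.update ![a, b, c, d] 3 x = ![a, b, c, x] := by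
  funext j
  fin_cases j <;> rfl

/-- a `4`-cochain only sees `(v 0, …, v 3)` [folklore] -/
private theorem cochain4_apply_eq (f : Cochain ℂ gl3 𝒟.V 4) (v : Fin 4 → gl3) :
    f v = f ![v 0, v 1, v 2, v 3] := by
  congr 1
  funext j
  fin_cases j <;> rfl

/-- transposing slots `0`, `1` changes the sign [folklore] -/
private theorem swap4_01 (f : Cochain ℂ gl3 𝒟.V 4) (a b c d : gl3) :
    f ![b, a, c, d] = -f ![a, b, c, d] := by
  have h := f.map_swap ![a, b, c, d] (i := 0) (j := 1) (by decide)
  have e : (![a, b, c, d] : Fin 4 → gl3) ∘ Equiv.swap 0 1 = ![b, a, c, d] := by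
    funext k
    fin_cases k <;> rfl
  rw [e] at h
  exact h

/-- transposing slots `0`, `2` changes the sign [folklore] -/
private theorem swap4_02 (f : Cochain ℂ gl3 𝒟.V 4) (a b c d : gl3) :
    f ![c, b, a, d] = -f ![a, b, c, d] := by
  have h := f.map_swap ![a, b, c, d] (i := 0) (j := 2) (by decide)
  have e : (![a, b, c, d] : Fin 4 → gl3) ∘ Equiv.swap 0 2 = ![c, b, a, d] := by
    funext k
    fin_cases k <;> rfl
  rw [e] at h
  exact h

/-- transposing slots `0`, `3` changes the sign [folklore] -/
private theorem swap4_03 (f : Cochain ℂ gl3 𝒟.V 4) (a b c d : gl3) :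
    f ![d, b, c, a] = -f ![a, b, c, d] := by
  have h := f.map_swap ![a, b, c, d] (i := 0) (j := 3) (by decide)
  have e : (![a, b, c, d] : Fin 4 → gl3) ∘ Equiv.swap 0 3 = ![d, b, c, a] := by
    funext k
    fin_cases k <;> rfl
  rw [e] at h
  exact h

/-- transposing slots `1`, `2` changes the sign [folklore] -/
private theorem swap4_12 (f : Cochain ℂ gl3 𝒟.V 4) (a b c d : gl3) :
    f ![a, c, b, d] = -f ![a, b, c, d] := by
  have h := f.map_swap ![a, b, c, d] (i := 1) (j := 2) (by decide)
  have e : (![a, b, c, d] : Fin 4 → gl3) ∘ Equiv.swap 1 2 = ![a, c, b, d] := by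
    funext k
    fin_cases k <;> rfl
  rw [e] at h
  exact h

/-- transposing slots `1`, `3` changes the sign [folklore] -/
private theorem swap4_13 (f : Cochain ℂ gl3 𝒟.V 4) (a b c d : gl3) :
    f ![a, d, c, b] = -f ![a, b, c, d] := by
  have h := f.map_swap ![a, b, c, d] (i := 1) (j := 3) (by decide)
  have e : (![a, b, c, d] : Fin 4 → gl3) ∘ Equiv.swap 1 3 = ![a, d, c, b] := by
    funext k
    fin_cases k <;> rfl
  rw [e] at h
  exact h

/-- transposing slots `2`, `3` changes the sign [folklore] -/
private theorem swap4_23 (f : Cochain ℂ gl3 𝒟.V 4) (a b c d : gl3) :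
    f ![a, b, d, c] = -f ![a, b, c, d] := by
  have h := f.map_swap ![a, b, c, d] (i := 2) (j := 3) (by decide)
  have e : (![a, b, c, d] : Fin 4 → gl3) ∘ Equiv.swap 2 3 = ![a, b, d, c] := by
    funext k
    fin_cases k <;> rfl
  rw [e] at h
  exact h

/-- equal entries in slots `0`, `1` give `0` [folklore] -/
private theorem self4_01 (f : Cochain ℂ gl3 𝒟.V 4) (a c d : gl3) : f ![a, a, c, d] = 0 :=
  f.map_eq_zero_of_eq ![a, a, c, d] (i := 0) (j := 1) rfl (by decide)

/-- equal entries in slots `0`, `2` give `0` [folklore] -/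
private theorem self4_02 (f : Cochain ℂ gl3 𝒟.V 4) (a b d : gl3) : f ![a, b, a, d] = 0 :=
  f.map_eq_zero_of_eq ![a, b, a, d] (i := 0) (j := 2) rfl (by decide)

/-- equal entries in slots `0`, `3` give `0` [folklore] -/
private theorem self4_03 (f : Cochain ℂ gl3 𝒟.V 4) (a b c : gl3) : f ![a, b, c, a] = 0 :=
  f.map_eq_zero_of_eq ![a, b, c, a] (i := 0) (j := 3) rfl (by decide)

/-- equal entries in slots `1`, `2` give `0` [folklore] -/
private theorem self4_12 (f : Cochain ℂ gl3 𝒟.V 4) (a b d : gl3) : f ![a, b, b, d] = 0 :=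
  f.map_eq_zero_of_eq ![a, b, b, d] (i := 1) (j := 2) rfl (by decide)

/-- equal entries in slots `1`, `3` give `0` [folklore] -/
private theorem self4_13 (f : Cochain ℂ gl3 𝒟.V 4) (a b c : gl3) : f ![a, b, c, b] = 0 :=
  f.map_eq_zero_of_eq ![a, b, c, b] (i := 1) (j := 3) rfl (by decide)

/-- equal entries in slots `2`, `3` give `0` [folklore] -/
private theorem self4_23 (f : Cochain ℂ gl3 𝒟.V 4) (a b c : gl3) : f ![a, b, c, c] = 0 :=
  f.map_eq_zero_of_eq ![a, b, c, c] (i := 2) (j := 3) rfl (by decide)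

/-- homogeneity in slot `0` [folklore] -/
private theorem smul4_0 (f : Cochain ℂ gl3 𝒟.V 4) (r : ℂ) (a b c d : gl3) :
    f ![r • a, b, c, d] = r • f ![a, b, c, d] := by
  have h := f.map_update_smul (v := ![a, b, c, d]) 0 r a
  simpa only [upd4_0] using h

/-- a zero entry in slot `0` gives `0` [folklore] -/
private theorem zero4_0 (f : Cochain ℂ gl3 𝒟.V 4) (b c d : gl3) : f ![(0 : gl3), b, c, d] = 0 :=
  f.map_coord_zero (m := ![(0 : gl3), b, c, d]) 0 rfl

/-- homogeneity in slot `1` [folklore] -/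
private theorem smul4_1 (f : Cochain ℂ gl3 𝒟.V 4) (r : ℂ) (a b c d : gl3) :
    f ![a, r • b, c, d] = r • f ![a, b, c, d] := by
  have h := f.map_update_smul (v := ![a, b, c, d]) 1 r b
  simpa only [upd4_1] using h

/-- negation in slot `1` [folklore] -/
private theorem neg4_1 (f : Cochain ℂ gl3 𝒟.V 4) (a b c d : gl3) :
    f ![a, -b, c, d] = -f ![a, b, c, d] := by
  rw [← neg_one_smul ℂ b, smul4_1, neg_one_smul]

/-- homogeneity in slot `2` [folklore] -/
private theorem smul4_2 (f : Cochain ℂ gl3 𝒟.V 4) (r : ℂ) (a b c d : gl3) :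
    f ![a, b, r • c, d] = r • f ![a, b, c, d] := by
  have h := f.map_update_smul (v := ![a, b, c, d]) 2 r c
  simpa only [upd4_2] using h

/-- negation in slot `2` [folklore] -/
private theorem neg4_2 (f : Cochain ℂ gl3 𝒟.V 4) (a b c d : gl3) :
    f ![a, b, -c, d] = -f ![a, b, c, d] := by
  rw [← neg_one_smul ℂ c, smul4_2, neg_one_smul]

/-- homogeneity in slot `3` [folklore] -/
private theorem smul4_3 (f : Cochain ℂ gl3 𝒟.V 4) (r : ℂ) (a b c d : gl3) :
    f ![a, b, c, r • d] = r • f ![a, b, c, d] := by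
  have h := f.map_update_smul (v := ![a, b, c, d]) 3 r d
  simpa only [upd4_3] using h

/-- a zero entry in slot `3` gives `0` [folklore] -/
private theorem zero4_3 (f : Cochain ℂ gl3 𝒟.V 4) (a b c : gl3) : f ![a, b, c, (0 : gl3)] = 0 :=
  f.map_coord_zero (m := ![a, b, c, (0 : gl3)]) 3 rfl

end Slots

/-! ### Degree `4` -/

section Four

variable {𝒟} {f : Cochain ℂ gl3 𝒟.V 4}

/-- `𝔨`-equivariance of a relative `4`-cochain. [cite: ChevalleyEilenberg1948, §28 (28.2)] -/
theorem four_equivariant (hf : f ∈ 𝒟.relCochain 4) {x : gl3} (hx : x ∈ kSub) (y z w u : gl3) :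
    ⁅x, f ![y, z, w, u]⁆ = f ![⁅x, y⁆, z, w, u] + f ![y, ⁅x, z⁆, w, u] + f ![y, z, ⁅x, w⁆, u] + f ![y, z, w, ⁅x, u⁆] := by
  have e : lieDer ℂ gl3 𝒟.V 4 x f ![y, z, w, u] = (0 : Cochain ℂ gl3 𝒟.V 4) ![y, z, w, u] := by
    rw [((Subcomplex.mem_rel_succ_iff kSub 3 f).1 hf x hx).1]
  rw [lieDer_four_apply, AlternatingMap.zero_apply, sub_sub, sub_sub, sub_sub, sub_eq_zero] at e
  rw [e, add_assoc, add_assoc]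

/-- `f(E₀₂, E₁₂, E₂₀, E₂₁)` is `𝔨`-invariant (`Λ⁴𝔭 = Λ²𝔭⁺ ⊗ Λ²𝔭⁻ = F_{0,0} = V_{1,0}`).
[cite: BorelWallach2000, VI 4.8 (5), Lemma 4.9] -/
theorem apply_T_mem_hwSpace (hf : f ∈ 𝒟.relCochain 4) : f ![E 0 2, E 1 2, E 2 0, E 2 1] ∈ 𝒟.hwSpace 1 0 := by
  obtain ⟨a1, a2, a3⟩ := lie_E02
  obtain ⟨b1, b2, b3, -⟩ := lie_E12
  obtain ⟨c1, c2, c3, -⟩ := lie_E20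
  obtain ⟨d1, d2, d3⟩ := lie_E21
  rw [mem_hwSpace_iff_lie, four_equivariant hf (E_mem_kSub 0 1 (by decide)), a1, b1, c1, d1,
    four_equivariant hf (kSub.sub_mem (E_mem_kSub 0 0 (by decide)) (E_mem_kSub 1 1 (by decide))), a2, b2, c2, d2,
    four_equivariant hf (kSub.sub_mem (kSub.add_mem (E_mem_kSub 0 0 (by decide)) (E_mem_kSub 1 1 (by decide)))
      (kSub.smul_mem _ (E_mem_kSub 2 2 (by decide)))), a3, b3, c3, d3]
  simp only [zero4_0, zero4_3, self4_01, self4_23, neg4_1, neg4_2, smul4_0, smul4_1, smul4_2, smul4_3]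
  push_cast
  refine ⟨by module, by module, by module⟩

/-- **`C⁴(𝔤, 𝔨; V) = 0` if `V_{1,0}` is not a `K`-type of `V`.** [cite: BorelWallach2000, VI Thm 4.11 (11)] -/
theorem relCochain_four_eq_bot (h : ((1 : ℤ), (0 : ℤ)) ∉ 𝒟.S) : 𝒟.relCochain 4 = ⊥ := by
  rw [Submodule.eq_bot_iff]
  intro f hf
  have hT : f ![E 0 2, E 1 2, E 2 0, E 2 1] = 0 := by
    have h' := apply_T_mem_hwSpace hf
    rwa [hwSpace_eq_span, vec_of_not_mem 1 h, Submodule.span_zero_singleton, Submodule.mem_bot] at h'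
  have q1 : f ![E 0 2, E 1 2, E 2 1, E 2 0] = 0 := by
    rw [swap4_23 f (E 0 2) (E 1 2) (E 2 0) (E 2 1), hT]
    simp
  have q2 : f ![E 0 2, E 2 0, E 1 2, E 2 1] = 0 := by
    rw [swap4_12 f (E 0 2) (E 1 2) (E 2 0) (E 2 1), hT]
    simp
  have q3 : f ![E 0 2, E 2 0, E 2 1, E 1 2] = 0 := by
    rw [swap4_23 f (E 0 2) (E 2 0) (E 1 2) (E 2 1), swap4_12 f (E 0 2) (E 1 2) (E 2 0) (E 2 1), hT]
    simp
  have q4 : f ![E 0 2, E 2 1, E 1 2, E 2 0] = 0 := by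
    rw [swap4_13 f (E 0 2) (E 2 0) (E 1 2) (E 2 1), swap4_12 f (E 0 2) (E 1 2) (E 2 0) (E 2 1), hT]
    simp
  have q5 : f ![E 0 2, E 2 1, E 2 0, E 1 2] = 0 := by
    rw [swap4_13 f (E 0 2) (E 1 2) (E 2 0) (E 2 1), hT]
    simp
  have q6 : f ![E 1 2, E 0 2, E 2 0, E 2 1] = 0 := by
    rw [swap4_01 f (E 0 2) (E 1 2) (E 2 0) (E 2 1), hT]
    simp
  have q7 : f ![E 1 2, E 0 2, E 2 1, E 2 0] = 0 := by
    rw [swap4_23 f (E 1 2) (E 0 2) (E 2 0) (E 2 1), swap4_01 f (E 0 2) (E 1 2) (E 2 0) (E 2 1), hT]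
    simp
  have q8 : f ![E 1 2, E 2 0, E 0 2, E 2 1] = 0 := by
    rw [swap4_12 f (E 1 2) (E 0 2) (E 2 0) (E 2 1), swap4_01 f (E 0 2) (E 1 2) (E 2 0) (E 2 1), hT]
    simp
  have q9 : f ![E 1 2, E 2 0, E 2 1, E 0 2] = 0 := by
    rw [swap4_23 f (E 1 2) (E 2 0) (E 0 2) (E 2 1), swap4_12 f (E 1 2) (E 0 2) (E 2 0) (E 2 1), swap4_01 f (E 0 2) (E 1 2) (E 2 0) (E 2 1), hT]
    simp
  have q10 : f ![E 1 2, E 2 1, E 0 2, E 2 0] = 0 := by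
    rw [swap4_13 f (E 1 2) (E 2 0) (E 0 2) (E 2 1), swap4_12 f (E 1 2) (E 0 2) (E 2 0) (E 2 1), swap4_01 f (E 0 2) (E 1 2) (E 2 0) (E 2 1), hT]
    simp
  have q11 : f ![E 1 2, E 2 1, E 2 0, E 0 2] = 0 := by
    rw [swap4_13 f (E 1 2) (E 0 2) (E 2 0) (E 2 1), swap4_01 f (E 0 2) (E 1 2) (E 2 0) (E 2 1), hT]
    simp
  have q12 : f ![E 2 0, E 0 2, E 1 2, E 2 1] = 0 := by
    rw [swap4_02 f (E 1 2) (E 0 2) (E 2 0) (E 2 1), swap4_01 f (E 0 2) (E 1 2) (E 2 0) (E 2 1), hT]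
    simp
  have q13 : f ![E 2 0, E 0 2, E 2 1, E 1 2] = 0 := by
    rw [swap4_23 f (E 2 0) (E 0 2) (E 1 2) (E 2 1), swap4_02 f (E 1 2) (E 0 2) (E 2 0) (E 2 1), swap4_01 f (E 0 2) (E 1 2) (E 2 0) (E 2 1), hT]
    simp
  have q14 : f ![E 2 0, E 1 2, E 0 2, E 2 1] = 0 := by
    rw [swap4_02 f (E 0 2) (E 1 2) (E 2 0) (E 2 1), hT]
    simp
  have q15 : f ![E 2 0, E 1 2, E 2 1, E 0 2] = 0 := by
    rw [swap4_23 f (E 2 0) (E 1 2) (E 0 2) (E 2 1), swap4_02 f (E 0 2) (E 1 2) (E 2 0) (E 2 1), hT]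
    simp
  have q16 : f ![E 2 0, E 2 1, E 0 2, E 1 2] = 0 := by
    rw [swap4_13 f (E 2 0) (E 1 2) (E 0 2) (E 2 1), swap4_02 f (E 0 2) (E 1 2) (E 2 0) (E 2 1), hT]
    simp
  have q17 : f ![E 2 0, E 2 1, E 1 2, E 0 2] = 0 := by
    rw [swap4_13 f (E 2 0) (E 0 2) (E 1 2) (E 2 1), swap4_02 f (E 1 2) (E 0 2) (E 2 0) (E 2 1), swap4_01 f (E 0 2) (E 1 2) (E 2 0) (E 2 1), hT]
    simp
  have q18 : f ![E 2 1, E 0 2, E 1 2, E 2 0] = 0 := by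
    rw [swap4_03 f (E 2 0) (E 0 2) (E 1 2) (E 2 1), swap4_02 f (E 1 2) (E 0 2) (E 2 0) (E 2 1), swap4_01 f (E 0 2) (E 1 2) (E 2 0) (E 2 1), hT]
    simp
  have q19 : f ![E 2 1, E 0 2, E 2 0, E 1 2] = 0 := by
    rw [swap4_03 f (E 1 2) (E 0 2) (E 2 0) (E 2 1), swap4_01 f (E 0 2) (E 1 2) (E 2 0) (E 2 1), hT]
    simp
  have q20 : f ![E 2 1, E 1 2, E 0 2, E 2 0] = 0 := by
    rw [swap4_03 f (E 2 0) (E 1 2) (E 0 2) (E 2 1), swap4_02 f (E 0 2) (E 1 2) (E 2 0) (E 2 1), hT]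
    simp
  have q21 : f ![E 2 1, E 1 2, E 2 0, E 0 2] = 0 := by
    rw [swap4_03 f (E 0 2) (E 1 2) (E 2 0) (E 2 1), hT]
    simp
  have q22 : f ![E 2 1, E 2 0, E 0 2, E 1 2] = 0 := by
    rw [swap4_12 f (E 2 1) (E 0 2) (E 2 0) (E 1 2), swap4_03 f (E 1 2) (E 0 2) (E 2 0) (E 2 1), swap4_01 f (E 0 2) (E 1 2) (E 2 0) (E 2 1), hT]
    simp
  have q23 : f ![E 2 1, E 2 0, E 1 2, E 0 2] = 0 := by
    rw [swap4_12 f (E 2 1) (E 1 2) (E 2 0) (E 0 2), swap4_03 f (E 0 2) (E 1 2) (E 2 0) (E 2 1), hT]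
    simp
  refine AlternatingMap.ext fun v => ?_
  rw [cochain4_apply_eq f v, AlternatingMap.zero_apply]
  generalize v 0 = y
  generalize v 1 = z
  generalize v 2 = w
  generalize v 3 = u
  rw [slot_expand4 hf ![y, z, w, u] 0]
  simp only [upd4_0, Matrix.cons_val_zero]
  rw [slot_expand4 hf ![E 0 2, z, w, u] 1, slot_expand4 hf ![E 1 2, z, w, u] 1, slot_expand4 hf ![E 2 0, z, w, u] 1, slot_expand4 hf ![E 2 1, z, w, u] 1]
  simp only [upd4_1, Matrix.cons_val_one, self4_01, smul_zero, add_zero, zero_add]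
  rw [slot_expand4 hf ![E 0 2, E 1 2, w, u] 2,
    slot_expand4 hf ![E 0 2, E 2 0, w, u] 2,
    slot_expand4 hf ![E 0 2, E 2 1, w, u] 2,
    slot_expand4 hf ![E 1 2, E 0 2, w, u] 2,
    slot_expand4 hf ![E 1 2, E 2 0, w, u] 2,
    slot_expand4 hf ![E 1 2, E 2 1, w, u] 2,
    slot_expand4 hf ![E 2 0, E 0 2, w, u] 2,
    slot_expand4 hf ![E 2 0, E 1 2, w, u] 2,
    slot_expand4 hf ![E 2 0, E 2 1, w, u] 2,
    slot_expand4 hf ![E 2 1, E 0 2, w, u] 2,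
    slot_expand4 hf ![E 2 1, E 1 2, w, u] 2,
    slot_expand4 hf ![E 2 1, E 2 0, w, u] 2]
  simp only [upd4_2, Matrix.cons_val_two, Matrix.tail_cons, Matrix.head_cons, self4_02, self4_12, smul_zero, add_zero,
    zero_add]
  rw [slot_expand4 hf ![E 0 2, E 1 2, E 2 0, u] 3,
    slot_expand4 hf ![E 0 2, E 1 2, E 2 1, u] 3,
    slot_expand4 hf ![E 0 2, E 2 0, E 1 2, u] 3,
    slot_expand4 hf ![E 0 2, E 2 0, E 2 1, u] 3,
    slot_expand4 hf ![E 0 2, E 2 1, E 1 2, u] 3,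
    slot_expand4 hf ![E 0 2, E 2 1, E 2 0, u] 3,
    slot_expand4 hf ![E 1 2, E 0 2, E 2 0, u] 3,
    slot_expand4 hf ![E 1 2, E 0 2, E 2 1, u] 3,
    slot_expand4 hf ![E 1 2, E 2 0, E 0 2, u] 3,
    slot_expand4 hf ![E 1 2, E 2 0, E 2 1, u] 3,
    slot_expand4 hf ![E 1 2, E 2 1, E 0 2, u] 3,
    slot_expand4 hf ![E 1 2, E 2 1, E 2 0, u] 3,
    slot_expand4 hf ![E 2 0, E 0 2, E 1 2, u] 3,
    slot_expand4 hf ![E 2 0, E 0 2, E 2 1, u] 3,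
    slot_expand4 hf ![E 2 0, E 1 2, E 0 2, u] 3,
    slot_expand4 hf ![E 2 0, E 1 2, E 2 1, u] 3,
    slot_expand4 hf ![E 2 0, E 2 1, E 0 2, u] 3,
    slot_expand4 hf ![E 2 0, E 2 1, E 1 2, u] 3,
    slot_expand4 hf ![E 2 1, E 0 2, E 1 2, u] 3,
    slot_expand4 hf ![E 2 1, E 0 2, E 2 0, u] 3,
    slot_expand4 hf ![E 2 1, E 1 2, E 0 2, u] 3,
    slot_expand4 hf ![E 2 1, E 1 2, E 2 0, u] 3,
    slot_expand4 hf ![E 2 1, E 2 0, E 0 2, u] 3,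
    slot_expand4 hf ![E 2 1, E 2 0, E 1 2, u] 3]
  simp only [upd4_3, Matrix.cons_val_three, Matrix.tail_cons, Matrix.head_cons, self4_03, self4_13, self4_23, hT,
    q1, q2, q3, q4, q5, q6, q7, q8, q9, q10, q11, q12, q13, q14, q15, q16, q17, q18, q19, q20, q21, q22, q23,
    smul_zero, add_zero]

end Four

end SU21Datum

end Literature.RepresentationTheory.Kovacevic2021
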